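import Summits.QuantumFields.YangMills.Theorems.BalabanUVNodesN19JacksonSteklovSmoothing
import Mathlib.MeasureTheory.Integral.IntervalIntegral.IntegrationByParts
import Mathlib.Analysis.Calculus.MeanValue

/-!
# YM-DAG node N19 (= NE7 proper) — THE JACKSON MEAN OF A `C^{1,1}` PERIODIC FUNCTION IS SECOND-ORDER ACCURATE
# (`∫v²f_L² ≤ 4π³∕L`, `|J_L f − f| ≤ Lip(f′)·π⁶∕(8L²)`, and the `C^{1,1}` constant `Lip(f′)` passes through the positive kernel)

Cell `pub-ymgap`, HUMAN RULING D-0062 (Track A) ∕ D-0149, R141 (C) seat `pub-ymgap-dag-n19-e` (s3 = ALTERNATIVE CURRENCY), generation g35,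
module 1 (lineage module 185).  Route `Summits/QuantumFields/YangMills/Theses/BalabanUVNodes.lean`, cluster item K3⁸ «SpineGivenEndpointR13SepCoPHV»
(stmt-QuantumFields-27366); filed `--supports` that item `--as helper` (it proves no registered stub).  COUNT-NEUTRAL: [folklore]∕[bookkeeping] over
Mathlib (`intervalIntegral.integral_mul_deriv_eq_deriv_mul`, `Convex.norm_image_sub_le_of_norm_hasDerivWithin_le`, `integral_zpow`) and, BY NAME,
`Literature.Probability.LatticeModels.FejerKernel` (`fejerKernel_le`, `fejerKernel_le_div_sq`), module 138 `…N19FejerMean`, module 165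
`…N19JacksonKernelMean` (`jacksonMean_eq_trigSum`, `le_integral_fejerKernel_sq`); no laws, no scheme object, no Theses import; NOT a discharge claim.

WHY (desk `numerics/OPEN-PROBLEM.md`, g34).  The last logarithm of the general row `E_d(t) ≤ 75000·d·log₂t∕t` (module 176) is the FIRST-ORDER
smoothing error `Kd(1∕π + 3π⁴∕32)∕L` of module 167 at the forced Jackson order `L ≍ t∕log t`.  For `f` with a `Λ′`-LIPSCHITZ DERIVATIVE the Jackson mean
`J_L f(θ) = (1∕Z)∫f(θ − v)f_L(v)²dv` is second-order accurate: the linear term of `f(θ − v) − f(θ) = −f′(θ)v + O(Λ′v²)` dies on the even kernel (§1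
`integral_mul_fejerKernel_sq_eq_zero`) and `∫v²f_L² ≤ 4π³∕L` against `Z ≥ 32L∕π³` (§1 `integral_sq_mul_fejerKernel_sq_le`) ⇒ `|J_L f − f| ≤ Λ′π⁶∕(8L²)`
(§2 `abs_jacksonMean_sub_le_of_deriv`); module 151's `C^{1,1}` datum is `B₂ = Λ′` itself (positivity, §2 `abs_jacksonMean_taylor_le`, with
`g₁ = J_L(f′)`) and `|g₁| ≤ sup|f′|`
(§2 `abs_jacksonMean_le`) — no Steklov box, no `δ`.  The sequel (lineage 186 `…N19JacksonSmoothingC11`) packages this as module 151's input (the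
formal derivative of the trigonometric sum `J_L f` is `J_L(f′)`, by parts); lineage 187–188 run module 176's budget with it: `C²` links are LOG-FREE.

HONEST FRAMING (binding).  Elementary and [folklore] (the Jackson integral for `ω₂`: Butzer–Nessel 1971 §1.5, DeVore 1972; constants crude); NO
consumer in the DAG today (degree model of the seat's own currency map); nothing of Bałaban's instantiated; NE7 NOT PRINTED, NOT proved; N19 NOT
discharged; count-neutral.  One finite `T⁴` programme at fixed `ε`; nothing continuum ∕ `ℝ⁴` ∕ OS ∕ mass-gap ∕ Clay.  0 `def` ∕ 0 `sorry`.
-/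

noncomputable section

open Finset MeasureTheory intervalIntegral
open scoped Real

namespace Summit.QuantumFields.YangMills.Theorems.BalabanUVNodesN19JacksonMeanSecondOrder

open Literature.Probability.LatticeModels (fejerKernel fejerKernel_nonneg fejerKernel_le fejerKernel_le_div_sq)
open Summit.QuantumFields.YangMills.Theorems.BalabanUVNodesN19FejerMean (continuous_fejerKernel fejerKernel_neg abs_fourierCoeff_le)
open Summit.QuantumFields.YangMills.Theorems.BalabanUVNodesN19JacksonKernelMean (jacksonMean_eq_trigSum le_integral_fejerKernel_sq)

/-! ## §1 The Jackson kernel `f_L²`: vanishing first moment, second moment `O(1∕L)` [folklore] -/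

/-- **THE FIRST MOMENT OF THE (EVEN) JACKSON KERNEL VANISHES**: `∫_{−π}^{π} v·f_L(v)² dv = 0`. [folklore] -/
theorem integral_mul_fejerKernel_sq_eq_zero (L : ℕ) : ∫ v in (-π)..π, v * fejerKernel L v ^ 2 = 0 := by
  have e : ∫ v in (-π)..π, v * fejerKernel L v ^ 2 = ∫ v in (-π)..π, (-v) * fejerKernel L (-v) ^ 2 := by
    rw [intervalIntegral.integral_comp_neg fun v => v * fejerKernel L v ^ 2, neg_neg]
  have e2 : ∫ v in (-π)..π, (-v) * fejerKernel L (-v) ^ 2 = -∫ v in (-π)..π, v * fejerKernel L v ^ 2 := by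
    rw [← intervalIntegral.integral_neg]
    exact intervalIntegral.integral_congr fun v _ => by simp only [fejerKernel_neg]; ring
  linarith [e, e2]

/-- **THE SECOND MOMENT OF THE JACKSON KERNEL**: `∫_{−π}^{π} v²·f_L(v)² dv ≤ 4π³∕L` (`L ≥ 1`; middle `|v| ≤ π∕L` by `f_L ≤ L`, tails by
`f_L(v) ≤ π²∕(Lv²)`).  Against `Z = ∫f_L² ≥ 32L∕π³` this is the `1∕L²` of the second-order Jackson estimate. [folklore] -/
theorem integral_sq_mul_fejerKernel_sq_le {L : ℕ} (hL : 1 ≤ L) :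
    ∫ v in (-π)..π, v ^ 2 * fejerKernel L v ^ 2 ≤ 4 * π ^ 3 / L := by
  have hLr : (0 : ℝ) < L := by exact_mod_cast hL
  have hπ := Real.pi_pos
  set a : ℝ := π / L with ha
  have ha0 : 0 < a := div_pos hπ hLr
  have haπ : a ≤ π := div_le_self hπ.le (by exact_mod_cast hL)
  have hcont : Continuous fun v : ℝ => v ^ 2 * fejerKernel L v ^ 2 := (continuous_pow 2).mul ((continuous_fejerKernel L).pow 2)
  have hii : ∀ b c : ℝ, IntervalIntegrable (fun v : ℝ => v ^ 2 * fejerKernel L v ^ 2) volume b c :=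
    fun b c => hcont.intervalIntegrable _ _
  -- middle
  have hmid : ∫ v in (-a)..a, v ^ 2 * fejerKernel L v ^ 2 ≤ 2 * π ^ 3 / L := by
    have h1 : ∫ v in (-a)..a, v ^ 2 * fejerKernel L v ^ 2 ≤ ∫ _v in (-a)..a, a ^ 2 * L ^ 2 := by
      refine intervalIntegral.integral_mono_on (by linarith) (hii _ _) (by simp) fun v hv => ?_
      have hf : fejerKernel L v ^ 2 ≤ (L : ℝ) ^ 2 := pow_le_pow_left₀ (fejerKernel_nonneg L v) (fejerKernel_le L v) 2
      have hv2 : v ^ 2 ≤ a ^ 2 := by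
        rw [← sq_abs v]; exact pow_le_pow_left₀ (abs_nonneg v) (abs_le.2 ⟨by linarith [hv.1], hv.2⟩) 2
      exact mul_le_mul hv2 hf (by positivity) (by positivity)
    rw [intervalIntegral.integral_const, smul_eq_mul] at h1
    have e : (a - -a) * (a ^ 2 * (L : ℝ) ^ 2) = 2 * π ^ 3 / L := by rw [ha]; field_simp; ring
    linarith [h1, e.le, e.ge]
  -- right tail
  have hright : ∫ v in a..π, v ^ 2 * fejerKernel L v ^ 2 ≤ π ^ 3 / L := by
    have h0a : (0 : ℝ) ∉ Set.uIcc a π := by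
      rw [Set.uIcc_of_le haπ]; exact fun h => by linarith [h.1]
    have hI : ∫ v in a..π, v ^ (-2 : ℤ) = a⁻¹ - π⁻¹ := by
      rw [integral_zpow (Or.inr ⟨by norm_num, h0a⟩)]
      have e : (-2 : ℤ) + 1 = -1 := by norm_num
      rw [e, zpow_neg, zpow_neg, zpow_one, zpow_one]
      push_cast
      ring
    have h1 : ∫ v in a..π, v ^ 2 * fejerKernel L v ^ 2 ≤ ∫ v in a..π, (π ^ 4 / L ^ 2) * v ^ (-2 : ℤ) := by
      refine intervalIntegral.integral_mono_on haπ (hii _ _) ((intervalIntegral.intervalIntegrable_zpow (Or.inr h0a)).const_mul _)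
        fun v hv => ?_
      have hv0 : 0 < v := ha0.trans_le hv.1
      have hd := fejerKernel_le_div_sq hL hv0.ne' (show |v| ≤ π by rw [abs_of_pos hv0]; exact hv.2)
      have hf2 : fejerKernel L v ^ 2 ≤ (π ^ 2 / (L * v ^ 2)) ^ 2 := pow_le_pow_left₀ (fejerKernel_nonneg L v) hd 2
      calc v ^ 2 * fejerKernel L v ^ 2 ≤ v ^ 2 * (π ^ 2 / (L * v ^ 2)) ^ 2 := mul_le_mul_of_nonneg_left hf2 (by positivity)
        _ = (π ^ 4 / L ^ 2) * v ^ (-2 : ℤ) := by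
            rw [zpow_neg, zpow_ofNat]; field_simp
    rw [intervalIntegral.integral_const_mul, hI] at h1
    have e : π ^ 4 / (L : ℝ) ^ 2 * (a⁻¹ - π⁻¹) = π ^ 3 / L - π ^ 3 / L ^ 2 := by
      rw [ha]; field_simp
    rw [e] at h1
    have hpos : 0 ≤ π ^ 3 / (L : ℝ) ^ 2 := by positivity
    linarith [h1, hpos]
  -- left tail by symmetry
  have hleft : ∫ v in (-π)..(-a), v ^ 2 * fejerKernel L v ^ 2 ≤ π ^ 3 / L := by
    have e : ∫ v in (-π)..(-a), v ^ 2 * fejerKernel L v ^ 2 = ∫ v in a..π, v ^ 2 * fejerKernel L v ^ 2 := by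
      rw [← intervalIntegral.integral_comp_neg fun v => v ^ 2 * fejerKernel L v ^ 2]
      simp only [neg_sq, fejerKernel_neg]
    rw [e]; exact hright
  have hsplit : ∫ v in (-π)..π, v ^ 2 * fejerKernel L v ^ 2 =
      (∫ v in (-π)..(-a), v ^ 2 * fejerKernel L v ^ 2) + ((∫ v in (-a)..a, v ^ 2 * fejerKernel L v ^ 2) +
        ∫ v in a..π, v ^ 2 * fejerKernel L v ^ 2) := by
    rw [intervalIntegral.integral_add_adjacent_intervals (hii _ _) (hii _ _),
      intervalIntegral.integral_add_adjacent_intervals (hii _ _) (hii _ _)]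
  rw [hsplit]
  have e : 4 * π ^ 3 / (L : ℝ) = π ^ 3 / L + (2 * π ^ 3 / L + π ^ 3 / L) := by ring
  rw [e]
  exact add_le_add hleft (add_le_add hmid hright)


/-! ## §2 The Jackson mean of a `C^{1,1}` periodic function [folklore] -/

/-- **TAYLOR AT FIRST ORDER WITH A LIPSCHITZ DERIVATIVE**: if `f′ = f₁` everywhere and `|f₁(a) − f₁(b)| ≤ Λ′|a − b|`, then
`|f(u) − f(a) − f₁(a)(u − a)| ≤ Λ′(u − a)²` (mean value on the segment; the sharp `½` is not needed). [folklore] -/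
theorem taylor_abs_le_of_lipschitz_deriv {f f₁ : ℝ → ℝ} {Λ' : ℝ} (hder : ∀ θ, HasDerivAt f (f₁ θ) θ)
    (hLip : ∀ a b, |f₁ a - f₁ b| ≤ Λ' * |a - b|) (u a : ℝ) : |f u - f a - f₁ a * (u - a)| ≤ Λ' * (u - a) ^ 2 := by
  have hΛ'0 : 0 ≤ Λ' := by have := (abs_nonneg _).trans (hLip 1 0); simpa using this
  have hφ : ∀ x ∈ Set.uIcc a u, HasDerivWithinAt (fun w => f w - f₁ a * w) (f₁ x - f₁ a) (Set.uIcc a u) x := by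
    intro x _
    have h1 : HasDerivAt (fun w => f₁ a * w) (f₁ a) x := by simpa using (hasDerivAt_id x).const_mul (f₁ a)
    exact ((hder x).sub h1).hasDerivWithinAt
  have hbound : ∀ x ∈ Set.uIcc a u, ‖f₁ x - f₁ a‖ ≤ Λ' * |u - a| := by
    intro x hx
    rw [Real.norm_eq_abs]
    exact (hLip x a).trans (mul_le_mul_of_nonneg_left (Set.abs_sub_left_of_mem_uIcc hx) hΛ'0)
  have key := Convex.norm_image_sub_le_of_norm_hasDerivWithin_le hφ hbound (convex_uIcc a u) Set.left_mem_uIcc Set.right_mem_uIcc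
  rw [Real.norm_eq_abs, Real.norm_eq_abs] at key
  rw [show f u - f a - f₁ a * (u - a) = (f u - f₁ a * u) - (f a - f₁ a * a) by ring]
  calc |(f u - f₁ a * u) - (f a - f₁ a * a)| ≤ Λ' * |u - a| * |u - a| := key
    _ = Λ' * (u - a) ^ 2 := by rw [mul_assoc, ← sq, sq_abs]

/-- A Lipschitz bound `|f₁(a) − f₁(b)| ≤ Λ′|a − b|` makes `f₁` continuous. [bookkeeping] -/
theorem continuous_of_abs_sub_le {f₁ : ℝ → ℝ} {Λ' : ℝ} (hLip : ∀ a b, |f₁ a - f₁ b| ≤ Λ' * |a - b|) : Continuous f₁ := by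
  have hΛ'0 : 0 ≤ Λ' := by have := (abs_nonneg _).trans (hLip 1 0); simpa using this
  refine continuous_iff_continuousAt.2 fun θ => Metric.continuousAt_iff.2 fun ε hε => ⟨ε / (Λ' + 1), by positivity, fun x hx => ?_⟩
  rw [Real.dist_eq] at hx ⊢
  calc |f₁ x - f₁ θ| ≤ Λ' * |x - θ| := hLip x θ
    _ ≤ (Λ' + 1) * |x - θ| := mul_le_mul_of_nonneg_right (by linarith) (abs_nonneg _)
    _ < (Λ' + 1) * (ε / (Λ' + 1)) := mul_lt_mul_of_pos_left hx (by linarith)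
    _ = ε := by field_simp

/-- **THE JACKSON MEAN OF A BOUNDED FUNCTION IS BOUNDED BY THE SAME CONSTANT** (positive kernel of unit mass). [folklore] -/
theorem abs_jacksonMean_le {φ : ℝ → ℝ} {B : ℝ} (hB : ∀ θ, |φ θ| ≤ B) {L : ℕ} (hL : 1 ≤ L) (θ : ℝ) :
    |(1 / ∫ v in (-π)..π, fejerKernel L v ^ 2) * ∫ v in (-π)..π, φ (θ - v) * fejerKernel L v ^ 2| ≤ B := by
  have hπ := Real.pi_pos
  have hLr : (0 : ℝ) < L := by exact_mod_cast hL
  set Z : ℝ := ∫ v in (-π)..π, fejerKernel L v ^ 2 with hZ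
  have hZ0 : 0 < Z := lt_of_lt_of_le (by positivity) (le_integral_fejerKernel_sq hL)
  have hK : Continuous fun v : ℝ => fejerKernel L v ^ 2 := (continuous_fejerKernel L).pow 2
  have hIB : IntervalIntegrable (fun v : ℝ => B * fejerKernel L v ^ 2) volume (-π) π := (continuous_const.mul hK).intervalIntegrable _ _
  have hbound : |∫ v in (-π)..π, φ (θ - v) * fejerKernel L v ^ 2| ≤ ∫ v in (-π)..π, B * fejerKernel L v ^ 2 := by
    rw [← Real.norm_eq_abs]
    refine intervalIntegral.norm_integral_le_of_norm_le (by linarith) (ae_of_all _ fun v _ => ?_) hIB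
    rw [Real.norm_eq_abs, abs_mul, abs_of_nonneg (by positivity : 0 ≤ fejerKernel L v ^ 2)]
    exact mul_le_mul_of_nonneg_right (hB _) (by positivity)
  rw [intervalIntegral.integral_const_mul] at hbound
  rw [abs_mul, abs_of_pos (by positivity : (0 : ℝ) < 1 / Z)]
  calc 1 / Z * |∫ v in (-π)..π, φ (θ - v) * fejerKernel L v ^ 2| ≤ 1 / Z * (B * Z) := mul_le_mul_of_nonneg_left hbound (by positivity)
    _ = B := by field_simp

/-- **THE `C^{1,1}` CONSTANT PASSES THROUGH THE JACKSON MEAN** (linearity and positivity): with `g = J_L f`, `g₁ = J_L f₁`,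
`|g(u) − g(a) − g₁(a)(u − a)| ≤ Λ′(u − a)²`. [folklore] -/
theorem abs_jacksonMean_taylor_le {f f₁ : ℝ → ℝ} {Λ' : ℝ} (hder : ∀ θ, HasDerivAt f (f₁ θ) θ)
    (hLip : ∀ a b, |f₁ a - f₁ b| ≤ Λ' * |a - b|) {L : ℕ} (hL : 1 ≤ L) (u a : ℝ) :
    |(1 / ∫ v in (-π)..π, fejerKernel L v ^ 2) * (∫ v in (-π)..π, f (u - v) * fejerKernel L v ^ 2) -
        (1 / ∫ v in (-π)..π, fejerKernel L v ^ 2) * (∫ v in (-π)..π, f (a - v) * fejerKernel L v ^ 2) -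
        (1 / ∫ v in (-π)..π, fejerKernel L v ^ 2) * (∫ v in (-π)..π, f₁ (a - v) * fejerKernel L v ^ 2) * (u - a)| ≤
      Λ' * (u - a) ^ 2 := by
  have hπ := Real.pi_pos
  have hLr : (0 : ℝ) < L := by exact_mod_cast hL
  set Z : ℝ := ∫ v in (-π)..π, fejerKernel L v ^ 2 with hZ
  have hZ0 : 0 < Z := lt_of_lt_of_le (by positivity) (le_integral_fejerKernel_sq hL)
  have hfc : Continuous f := continuous_iff_continuousAt.2 fun θ => (hder θ).continuousAt
  have hf₁c : Continuous f₁ := continuous_of_abs_sub_le hLip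
  have hK : Continuous fun v : ℝ => fejerKernel L v ^ 2 := (continuous_fejerKernel L).pow 2
  have hIu : IntervalIntegrable (fun v => f (u - v) * fejerKernel L v ^ 2) volume (-π) π :=
    ((hfc.comp (continuous_const.sub continuous_id)).mul hK).intervalIntegrable _ _
  have hIa : IntervalIntegrable (fun v => f (a - v) * fejerKernel L v ^ 2) volume (-π) π :=
    ((hfc.comp (continuous_const.sub continuous_id)).mul hK).intervalIntegrable _ _
  have hI1 : IntervalIntegrable (fun v => f₁ (a - v) * (u - a) * fejerKernel L v ^ 2) volume (-π) π :=
    ((((hf₁c.comp (continuous_const.sub continuous_id))).mul continuous_const).mul hK).intervalIntegrable _ _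
  have e1 : (∫ v in (-π)..π, f₁ (a - v) * fejerKernel L v ^ 2) * (u - a) = ∫ v in (-π)..π, f₁ (a - v) * (u - a) * fejerKernel L v ^ 2 := by
    rw [← intervalIntegral.integral_mul_const]
    exact intervalIntegral.integral_congr fun v _ => by ring
  have e2 : (∫ v in (-π)..π, f (u - v) * fejerKernel L v ^ 2) - (∫ v in (-π)..π, f (a - v) * fejerKernel L v ^ 2) -
      (∫ v in (-π)..π, f₁ (a - v) * (u - a) * fejerKernel L v ^ 2) =
      ∫ v in (-π)..π, (f (u - v) - f (a - v) - f₁ (a - v) * (u - a)) * fejerKernel L v ^ 2 := by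
    rw [← intervalIntegral.integral_sub hIu hIa, ← intervalIntegral.integral_sub (hIu.sub hIa) hI1]
    exact intervalIntegral.integral_congr fun v _ => by ring
  have hcomb : (1 / Z) * (∫ v in (-π)..π, f (u - v) * fejerKernel L v ^ 2) - (1 / Z) * (∫ v in (-π)..π, f (a - v) * fejerKernel L v ^ 2) -
      (1 / Z) * (∫ v in (-π)..π, f₁ (a - v) * fejerKernel L v ^ 2) * (u - a) =
      (1 / Z) * ∫ v in (-π)..π, (f (u - v) - f (a - v) - f₁ (a - v) * (u - a)) * fejerKernel L v ^ 2 := by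
    rw [← e2, ← e1]; ring
  rw [hcomb, abs_mul, abs_of_pos (by positivity : (0 : ℝ) < 1 / Z)]
  have hIB : IntervalIntegrable (fun v : ℝ => (Λ' * (u - a) ^ 2) * fejerKernel L v ^ 2) volume (-π) π :=
    (continuous_const.mul hK).intervalIntegrable _ _
  have hbound : |∫ v in (-π)..π, (f (u - v) - f (a - v) - f₁ (a - v) * (u - a)) * fejerKernel L v ^ 2| ≤
      ∫ v in (-π)..π, (Λ' * (u - a) ^ 2) * fejerKernel L v ^ 2 := by
    rw [← Real.norm_eq_abs]
    refine intervalIntegral.norm_integral_le_of_norm_le (by linarith) (ae_of_all _ fun v _ => ?_) hIB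
    rw [Real.norm_eq_abs, abs_mul, abs_of_nonneg (by positivity : 0 ≤ fejerKernel L v ^ 2)]
    refine mul_le_mul_of_nonneg_right ?_ (by positivity)
    have := taylor_abs_le_of_lipschitz_deriv hder hLip (u - v) (a - v)
    rwa [show u - v - (a - v) = u - a by ring] at this
  rw [intervalIntegral.integral_const_mul] at hbound
  calc 1 / Z * |∫ v in (-π)..π, (f (u - v) - f (a - v) - f₁ (a - v) * (u - a)) * fejerKernel L v ^ 2|
      ≤ 1 / Z * (Λ' * (u - a) ^ 2 * Z) := mul_le_mul_of_nonneg_left hbound (by positivity)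
    _ = Λ' * (u - a) ^ 2 := by field_simp

/-- **THE JACKSON MEAN OF A `C^{1,1}` FUNCTION IS SECOND-ORDER ACCURATE**: for `f` with `f′ = f₁` everywhere, `f₁` `Λ′`-Lipschitz, and `L ≥ 1`,
`|(1∕Z)∫_{−π}^{π} f(θ − v)f_L(v)² dv − f(θ)| ≤ Λ′·π⁶∕(8L²)` (the term `−f₁(θ)v` dies on the even kernel; `∫v²f_L² ≤ 4π³∕L`, `Z ≥ 32L∕π³`). [folklore] -/
theorem abs_jacksonMean_sub_le_of_deriv {f f₁ : ℝ → ℝ} {Λ' : ℝ} (hder : ∀ θ, HasDerivAt f (f₁ θ) θ)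
    (hLip : ∀ a b, |f₁ a - f₁ b| ≤ Λ' * |a - b|) {L : ℕ} (hL : 1 ≤ L) (θ : ℝ) :
    |(1 / ∫ v in (-π)..π, fejerKernel L v ^ 2) * (∫ v in (-π)..π, f (θ - v) * fejerKernel L v ^ 2) - f θ| ≤
      Λ' * π ^ 6 / (8 * L ^ 2) := by
  have hπ := Real.pi_pos
  have hLr : (0 : ℝ) < L := by exact_mod_cast hL
  set Z : ℝ := ∫ v in (-π)..π, fejerKernel L v ^ 2 with hZ
  have hZlow := le_integral_fejerKernel_sq hL
  have hZ0 : 0 < Z := lt_of_lt_of_le (by positivity) hZlow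
  have hΛ'0 : 0 ≤ Λ' := by have := (abs_nonneg _).trans (hLip 1 0); simpa using this
  have hfc : Continuous f := continuous_iff_continuousAt.2 fun θ => (hder θ).continuousAt
  have hfθ : Continuous fun v => f (θ - v) := hfc.comp (continuous_const.sub continuous_id)
  have hK : Continuous fun v : ℝ => fejerKernel L v ^ 2 := (continuous_fejerKernel L).pow 2
  have hI1 : IntervalIntegrable (fun v => f (θ - v) * fejerKernel L v ^ 2) volume (-π) π := (hfθ.mul hK).intervalIntegrable _ _
  have hI2 : IntervalIntegrable (fun v => (f θ - f₁ θ * v) * fejerKernel L v ^ 2) volume (-π) π :=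
    ((continuous_const.sub (continuous_const.mul continuous_id)).mul hK).intervalIntegrable _ _
  have hI3 : IntervalIntegrable (fun v => f θ * fejerKernel L v ^ 2) volume (-π) π := (continuous_const.mul hK).intervalIntegrable _ _
  have hI4 : IntervalIntegrable (fun v => f₁ θ * (v * fejerKernel L v ^ 2)) volume (-π) π :=
    (continuous_const.mul (continuous_id.mul hK)).intervalIntegrable _ _
  have hc2 : ∫ v in (-π)..π, (f θ - f₁ θ * v) * fejerKernel L v ^ 2 = f θ * Z := by
    have e : ∫ v in (-π)..π, (f θ - f₁ θ * v) * fejerKernel L v ^ 2 =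
        (∫ v in (-π)..π, f θ * fejerKernel L v ^ 2) - ∫ v in (-π)..π, f₁ θ * (v * fejerKernel L v ^ 2) := by
      rw [← intervalIntegral.integral_sub hI3 hI4]
      exact intervalIntegral.integral_congr fun v _ => by ring
    rw [e, intervalIntegral.integral_const_mul, intervalIntegral.integral_const_mul, integral_mul_fejerKernel_sq_eq_zero, mul_zero, sub_zero]
  have hsub : ∫ v in (-π)..π, (f (θ - v) - f θ - f₁ θ * (-v)) * fejerKernel L v ^ 2 =
      (∫ v in (-π)..π, f (θ - v) * fejerKernel L v ^ 2) - ∫ v in (-π)..π, (f θ - f₁ θ * v) * fejerKernel L v ^ 2 := by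
    rw [← intervalIntegral.integral_sub hI1 hI2]
    exact intervalIntegral.integral_congr fun v _ => by ring
  have hdiff : (1 / Z) * (∫ v in (-π)..π, f (θ - v) * fejerKernel L v ^ 2) - f θ =
      (1 / Z) * ∫ v in (-π)..π, (f (θ - v) - f θ - f₁ θ * (-v)) * fejerKernel L v ^ 2 := by
    rw [hsub, hc2]; field_simp
  rw [hdiff, abs_mul, abs_of_pos (by positivity : (0 : ℝ) < 1 / Z)]
  have hIB : IntervalIntegrable (fun v : ℝ => Λ' * (v ^ 2 * fejerKernel L v ^ 2)) volume (-π) π :=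
    (continuous_const.mul ((continuous_pow 2).mul hK)).intervalIntegrable _ _
  have hbound : |∫ v in (-π)..π, (f (θ - v) - f θ - f₁ θ * (-v)) * fejerKernel L v ^ 2| ≤
      ∫ v in (-π)..π, Λ' * (v ^ 2 * fejerKernel L v ^ 2) := by
    rw [← Real.norm_eq_abs]
    refine intervalIntegral.norm_integral_le_of_norm_le (by linarith) (ae_of_all _ fun v _ => ?_) hIB
    rw [Real.norm_eq_abs, abs_mul, abs_of_nonneg (by positivity : 0 ≤ fejerKernel L v ^ 2), ← mul_assoc]
    refine mul_le_mul_of_nonneg_right ?_ (by positivity)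
    have := taylor_abs_le_of_lipschitz_deriv hder hLip (θ - v) θ
    rwa [show θ - v - θ = -v by ring, neg_sq] at this
  rw [intervalIntegral.integral_const_mul] at hbound
  have hmom := integral_sq_mul_fejerKernel_sq_le hL
  calc 1 / Z * |∫ v in (-π)..π, (f (θ - v) - f θ - f₁ θ * (-v)) * fejerKernel L v ^ 2| ≤ 1 / Z * (Λ' * (4 * π ^ 3 / L)) :=
        mul_le_mul_of_nonneg_left (hbound.trans (mul_le_mul_of_nonneg_left hmom hΛ'0)) (by positivity)
    _ = Λ' * (4 * π ^ 3 / L) / Z := by ring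
    _ ≤ Λ' * (4 * π ^ 3 / L) / (32 * L / π ^ 3) := div_le_div_of_nonneg_left (by positivity) (by positivity) hZlow
    _ = Λ' * π ^ 6 / (8 * L ^ 2) := by field_simp; ring

end Summit.QuantumFields.YangMills.Theorems.BalabanUVNodesN19JacksonMeanSecondOrder

end
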